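import Mathlib
import Summits.Ventures.PercRepro2.Defs
import Summits.Ventures.PercRepro2.Graph
import Summits.Ventures.PercRepro2.Induced
import Summits.Ventures.PercRepro2.BHKAvoid
import Summits.Ventures.PercRepro2.YBridge
import Summits.Ventures.PercRepro2.PMK5Deg4Kernel

/-!
# `K₅ + {a₃x, a₃y, a₃z, a₃w}` in the tree's vocabulary, and the bitmask connectivity is `Conn` — the degree-4 family
(blind cell PercRepro2, mine-2 g28; the first bridge file of the fourteen-edge certificate
`PMK5Deg4Kernel.lean`; mine-2 g27's `Deg3Conn.lean` one edge up, parametrised by the attachment quadruple)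

`ends14 x y z w : Fin 14 → Sym2 (Fin 6)` is `K₅` on `o = 0, a₁ = 1, a₂ = 2, u = 3, b = 4` (edges `0..9`, lexicographic
pairs) plus `a₃ = 5` joined to `x` (edge `10`), to `y` (edge `11`), to `z` (edge `12`) and to `w` (edge `13`), `x, y, z, w : Fin 5`
(`edge14 x y z w`; `Deg4.ea x y z w`, `Deg4.eb` are its endpoints as numbers).  `conn_iff`: the bitmask closure
`Deg4.conn x y z w ω u v` is exactly the tree's connection relation `Conn (ends14 x y z w) ω u v` — the five closure
steps `step` add the open neighbours of the reached vertices (`testBit_step`, `testBit_nb`), so a reached vertex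
is reachable (`reachable_of_mem`) and every vertex at walk distance `≤ 5` is reached (`mem_of_walk`); a path in
a graph on six vertices has length `≤ 5`.  Hence the side tables are the indicators of the tree's events
(`tQ_iff`, `tL_iff`, `tH_iff`, `tPD_iff`, `tPDoU_iff`).
-/

namespace Summit.Ventures.PercRepro2

namespace Deg4

/-! ## The graph as a graph of the tree -/

/-- The endpoints of the fourteen edges (lexicographic pairs of `K₅`, then `a₃x`, `a₃y`, `a₃z`, `a₃w`). -/
def edge14 (x y z w : Fin 5) : Fin 14 → Fin 6 × Fin 6 :=
  ![(0, 1), (0, 2), (0, 3), (0, 4), (1, 2), (1, 3), (1, 4), (2, 3), (2, 4), (3, 4), (x.castSucc, 5),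
    (y.castSucc, 5), (z.castSucc, 5), (w.castSucc, 5)]

/-- `K₅ + {a₃x, a₃y, a₃z, a₃w}` on the six vertices, in the tree's vocabulary. -/
def ends14 (x y z w : Fin 5) : Fin 14 → Sym2 (Fin 6) := fun e => s((edge14 x y z w e).1, (edge14 x y z w e).2)

/-- `ea` is the first endpoint. -/
lemma ea_eq (x y z w : Fin 5) (e : Fin 14) : ea x y z w e = ((edge14 x y z w e).1 : ℕ) := by fin_cases e <;> rfl

/-- `eb` is the second endpoint. -/
lemma eb_eq (x y z w : Fin 5) (e : Fin 14) : eb e = ((edge14 x y z w e).2 : ℕ) := by fin_cases e <;> rfl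

/-- The endpoints are distinct. -/
lemma ea_ne_eb (x y z w : Fin 5) (e : Fin 14) : ea x y z w e ≠ eb e := by
  have hx := x.isLt
  have hy := y.isLt
  have hz := z.isLt
  have hw := w.isLt
  fin_cases e
  · show (0 : ℕ) ≠ 1; decide
  · show (0 : ℕ) ≠ 2; decide
  · show (0 : ℕ) ≠ 3; decide
  · show (0 : ℕ) ≠ 4; decide
  · show (1 : ℕ) ≠ 2; decide
  · show (1 : ℕ) ≠ 3; decide
  · show (1 : ℕ) ≠ 4; decide
  · show (2 : ℕ) ≠ 3; decide
  · show (2 : ℕ) ≠ 4; decide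
  · show (3 : ℕ) ≠ 4; decide
  · show (x : ℕ) ≠ 5; omega
  · show (y : ℕ) ≠ 5; omega
  · show (z : ℕ) ≠ 5; omega
  · show (w : ℕ) ≠ 5; omega

/-- The endpoints are below `6`. -/
lemma ea_lt (x y z w : Fin 5) (e : Fin 14) : ea x y z w e < 6 := by
  have hx := x.isLt
  have hy := y.isLt
  have hz := z.isLt
  have hw := w.isLt
  fin_cases e
  · show (0 : ℕ) < 6; decide
  · show (0 : ℕ) < 6; decide
  · show (0 : ℕ) < 6; decide
  · show (0 : ℕ) < 6; decide
  · show (1 : ℕ) < 6; decide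
  · show (1 : ℕ) < 6; decide
  · show (1 : ℕ) < 6; decide
  · show (2 : ℕ) < 6; decide
  · show (2 : ℕ) < 6; decide
  · show (3 : ℕ) < 6; decide
  · show (x : ℕ) < 6; omega
  · show (y : ℕ) < 6; omega
  · show (z : ℕ) < 6; omega
  · show (w : ℕ) < 6; omega

/-- The endpoints are below `6`. -/
lemma eb_lt (e : Fin 14) : eb e < 6 := by fin_cases e <;> decide

/-- `ends14 x y z w e = s(u, v)` iff `{ea e, eb e} = {u, v}`. -/
lemma ends14_eq_iff (x y z w : Fin 5) (e : Fin 14) (u v : Fin 6) :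
    ends14 x y z w e = s(u, v) ↔ (ea x y z w e = u ∧ eb e = v) ∨ (eb e = u ∧ ea x y z w e = v) := by
  rw [ea_eq, eb_eq x y z w]
  unfold ends14
  rw [Sym2.eq_iff]
  constructor
  · rintro (⟨h1, h2⟩ | ⟨h1, h2⟩)
    · exact Or.inl ⟨by rw [h1], by rw [h2]⟩
    · exact Or.inr ⟨by rw [h2], by rw [h1]⟩
  · rintro (⟨h1, h2⟩ | ⟨h1, h2⟩)
    · exact Or.inl ⟨Fin.ext h1, Fin.ext h2⟩
    · exact Or.inr ⟨Fin.ext h2, Fin.ext h1⟩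

/-! ## Bits of the closure -/

/-- A fold of `lor`s: bit `v` of `l.foldl (· ||| h ·) acc` is bit `v` of `acc` or of some `h x`. -/
lemma testBit_foldl_lor {α : Type*} (h : α → ℕ) (v : ℕ) :
    ∀ (l : List α) (acc : ℕ),
      (l.foldl (fun acc x => acc ||| h x) acc).testBit v =
        (acc.testBit v || l.any fun x => (h x).testBit v)
  | [], acc => by simp
  | x :: l, acc => by
    rw [List.foldl_cons, testBit_foldl_lor h v l, Nat.testBit_lor, List.any_cons]
    simp only [Bool.or_assoc]

/-- The neighbour contribution of one edge. -/
def nbEdge (x y z w : Fin 5) (ω : Fin 14 → Bool) (u : ℕ) (e : Fin 14) : ℕ :=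
  if ω e then (if ea x y z w e = u then 1 <<< eb e else if eb e = u then 1 <<< ea x y z w e else 0) else 0

/-- `nb` is a fold of `lor`s of the edge contributions. -/
lemma nb_eq_foldl (x y z w : Fin 5) (ω : Fin 14 → Bool) (u : ℕ) :
    nb x y z w ω u = (List.finRange 14).foldl (fun acc e => acc ||| nbEdge x y z w ω u e) 0 := by
  unfold nb
  congr 1
  funext acc e
  unfold nbEdge
  split_ifs <;> simp

/-- Bit `v` of `1 <<< k` is `v = k`. -/
lemma testBit_one_shiftLeft (k v : ℕ) : (1 <<< k).testBit v = decide (k = v) := by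
  rw [Nat.one_shiftLeft, Nat.testBit_two_pow]

/-- **Bit `v` of the neighbour mask of `u`**: some open edge joins `u` and `v`. -/
lemma testBit_nb (x y z w : Fin 5) (ω : Fin 14 → Bool) (u v : ℕ) :
    (nb x y z w ω u).testBit v = true ↔
      ∃ e, ω e = true ∧ ((ea x y z w e = u ∧ eb e = v) ∨ (eb e = u ∧ ea x y z w e = v)) := by
  rw [nb_eq_foldl, testBit_foldl_lor, Nat.zero_testBit, Bool.false_or, List.any_eq_true]
  constructor
  · rintro ⟨e, -, he⟩
    unfold nbEdge at he
    refine ⟨e, ?_⟩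
    by_cases hω : ω e = true
    · rw [if_pos hω] at he
      refine ⟨hω, ?_⟩
      by_cases h1 : ea x y z w e = u
      · rw [if_pos h1, testBit_one_shiftLeft, decide_eq_true_iff] at he
        exact Or.inl ⟨h1, he⟩
      · rw [if_neg h1] at he
        by_cases h2 : eb e = u
        · rw [if_pos h2, testBit_one_shiftLeft, decide_eq_true_iff] at he
          exact Or.inr ⟨h2, he⟩
        · rw [if_neg h2, Nat.zero_testBit] at he
          exact absurd he Bool.false_ne_true
    · rw [if_neg hω, Nat.zero_testBit] at he
      exact absurd he Bool.false_ne_true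
  · rintro ⟨e, hω, h⟩
    refine ⟨e, List.mem_finRange e, ?_⟩
    unfold nbEdge
    rw [if_pos hω]
    rcases h with ⟨h1, h2⟩ | ⟨h1, h2⟩
    · rw [if_pos h1, testBit_one_shiftLeft, decide_eq_true_iff]; exact h2
    · have h3 : ea x y z w e ≠ u := fun h3 => ea_ne_eb x y z w e (h3.trans h1.symm)
      rw [if_neg h3, if_pos h1, testBit_one_shiftLeft, decide_eq_true_iff]; exact h2

/-- The contribution of one vertex to a closure step. -/
def stepV (x y z w : Fin 5) (ω : Fin 14 → Bool) (R : ℕ) (u : ℕ) : ℕ := if R.testBit u then nb x y z w ω u else 0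

/-- `step` is a fold of `lor`s. -/
lemma step_eq_foldl (x y z w : Fin 5) (ω : Fin 14 → Bool) (R : ℕ) :
    step x y z w ω R = (List.range 6).foldl (fun acc u => acc ||| stepV x y z w ω R u) R := by
  unfold step
  congr 1
  funext acc u
  unfold stepV
  split_ifs <;> simp

/-- **Bit `v` of a closure step**: `v` was reached, or some reached `u < 6` has `v` as an open
neighbour. -/
lemma testBit_step (x y z w : Fin 5) (ω : Fin 14 → Bool) (R : ℕ) (v : ℕ) :
    (step x y z w ω R).testBit v = true ↔
      R.testBit v = true ∨ ∃ u, u < 6 ∧ R.testBit u = true ∧ (nb x y z w ω u).testBit v = true := by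
  rw [step_eq_foldl, testBit_foldl_lor, Bool.or_eq_true, List.any_eq_true]
  constructor
  · rintro (h | ⟨u, hu, h⟩)
    · exact Or.inl h
    · unfold stepV at h
      by_cases hR : R.testBit u = true
      · rw [if_pos hR] at h
        exact Or.inr ⟨u, List.mem_range.1 hu, hR, h⟩
      · rw [if_neg hR, Nat.zero_testBit] at h
        exact absurd h Bool.false_ne_true
  · rintro (h | ⟨u, hu, hR, h⟩)
    · exact Or.inl h
    · refine Or.inr ⟨u, List.mem_range.2 hu, ?_⟩
      unfold stepV
      rw [if_pos hR]
      exact h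

/-- Bits are preserved by a closure step. -/
lemma testBit_step_of_testBit (x y z w : Fin 5) (ω : Fin 14 → Bool) (R : ℕ) {v : ℕ}
    (h : R.testBit v = true) : (step x y z w ω R).testBit v = true :=
  (testBit_step x y z w ω R v).2 (Or.inl h)

/-! ## The closure is reachability -/

/-- The iterated closure. -/
def reachN (x y z w : Fin 5) (ω : Fin 14 → Bool) (u : ℕ) : ℕ → ℕ
  | 0 => 1 <<< u
  | n + 1 => step x y z w ω (reachN x y z w ω u n)

/-- `reach` is the five-fold closure. -/
lemma reach_eq (x y z w : Fin 5) (ω : Fin 14 → Bool) (u : ℕ) : reach x y z w ω u = reachN x y z w ω u 5 := rfl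

/-- The closures are increasing. -/
lemma testBit_reachN_succ (x y z w : Fin 5) (ω : Fin 14 → Bool) (u : ℕ) {n v : ℕ}
    (h : (reachN x y z w ω u n).testBit v = true) : (reachN x y z w ω u (n + 1)).testBit v = true :=
  testBit_step_of_testBit x y z w ω _ h

/-- The closures are increasing (general form). -/
lemma testBit_reachN_of_le (x y z w : Fin 5) (ω : Fin 14 → Bool) (u : ℕ) {n m v : ℕ} (hnm : n ≤ m)
    (h : (reachN x y z w ω u n).testBit v = true) : (reachN x y z w ω u m).testBit v = true := by
  induction hnm with
  | refl => exact h
  | step _ ih => exact testBit_reachN_succ x y z w ω u ih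

/-- An open neighbour of a reached vertex is reached one step later. -/
lemma testBit_reachN_succ_of_adj (x y z w : Fin 5) (ω : Fin 14 → Bool) (u : ℕ) {n : ℕ} {a b : Fin 6}
    (ha : (reachN x y z w ω u n).testBit a = true) (hab : OpenAdj (ends14 x y z w) ω a b) :
    (reachN x y z w ω u (n + 1)).testBit b = true := by
  refine (testBit_step x y z w ω _ b).2 (Or.inr ⟨a, a.isLt, ha, ?_⟩)
  rw [testBit_nb]
  obtain ⟨e, he, hends⟩ := hab
  exact ⟨e, he, (ends14_eq_iff x y z w e a b).1 hends⟩

/-- Soundness: a reached vertex is connected to the root. -/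
lemma reachable_of_mem (x y z w : Fin 5) (ω : Fin 14 → Bool) (u v : Fin 6) :
    ∀ {n : ℕ}, (reachN x y z w ω u n).testBit v = true → Conn (ends14 x y z w) ω u v
  | 0, h => by
    rw [reachN, testBit_one_shiftLeft, decide_eq_true_iff] at h
    rw [Fin.ext h]
    exact conn_refl (ends14 x y z w) ω v
  | n + 1, h => by
    rw [reachN, testBit_step] at h
    rcases h with h | ⟨a, ha6, ha, hav⟩
    · exact reachable_of_mem x y z w ω u v h
    · rw [testBit_nb] at hav
      obtain ⟨e, he, hev⟩ := hav
      have hadj : OpenAdj (ends14 x y z w) ω ⟨a, ha6⟩ v :=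
        ⟨e, he, (ends14_eq_iff x y z w e ⟨a, ha6⟩ v).2 hev⟩
      have hne : (⟨a, ha6⟩ : Fin 6) ≠ v := by
        rintro rfl
        rcases hev with ⟨h1, h2⟩ | ⟨h1, h2⟩
        · exact ea_ne_eb x y z w e (h1.trans h2.symm)
        · exact ea_ne_eb x y z w e (h2.trans h1.symm)
      exact (reachable_of_mem x y z w ω u ⟨a, ha6⟩ ha).trans
        ((openGraph_adj.2 ⟨hne, hadj⟩).reachable)

/-- Completeness along a walk: a walk of length `l` from a reached vertex ends in a vertex reached
`l` steps later. -/
lemma mem_of_walk (x y z w : Fin 5) (ω : Fin 14 → Bool) (u : ℕ) {a v : Fin 6}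
    (p : (openGraph (ends14 x y z w) ω).Walk a v) :
    ∀ {n : ℕ}, (reachN x y z w ω u n).testBit a = true →
      (reachN x y z w ω u (n + p.length)).testBit v = true := by
  induction p with
  | nil => intro n ha; simpa using ha
  | cons hadj _ ih =>
    intro n ha
    have := ih (testBit_reachN_succ_of_adj x y z w ω u ha (openGraph_adj.1 hadj).2)
    rw [SimpleGraph.Walk.length_cons, ← Nat.add_assoc]
    rwa [Nat.add_right_comm] at this

/-- **The bitmask closure is connectivity**: `conn ω u v = true ↔ Conn ends14 ω u v`. -/
theorem conn_iff (x y z w : Fin 5) (ω : Fin 14 → Bool) (u v : Fin 6) :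
    conn x y z w ω u v = true ↔ Conn (ends14 x y z w) ω u v := by
  unfold conn
  rw [reach_eq]
  refine ⟨reachable_of_mem x y z w ω u v, fun h => ?_⟩
  refine h.elim_path fun p => ?_
  have hlen : p.1.length ≤ 5 := by
    have := p.2.length_lt
    rw [Fintype.card_fin] at this
    omega
  have hmem : (reachN x y z w ω u (0 + p.1.length)).testBit v = true :=
    mem_of_walk x y z w ω u p.1 (by rw [reachN, testBit_one_shiftLeft]; simp)
  exact testBit_reachN_of_le x y z w ω u (by omega) hmem

/-- `conn` on numbers below `6`, for the tables. -/
lemma conn_iff' (x y z w : Fin 5) (ω : Fin 14 → Bool) {u v : ℕ} (hu : u < 6) (hv : v < 6) :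
    conn x y z w ω u v = true ↔ Conn (ends14 x y z w) ω ⟨u, hu⟩ ⟨v, hv⟩ :=
  conn_iff x y z w ω ⟨u, hu⟩ ⟨v, hv⟩

/-! ## The side tables are the tree's events -/

/-- The connection `u ↔ v` for numerals, as a set membership. -/
lemma conn_iff_mem (x y z w : Fin 5) (ω : Fin 14 → Bool) {u v : ℕ} (hu : u < 6) (hv : v < 6) :
    conn x y z w ω u v = true ↔ ω ∈ connEvent (ends14 x y z w) ⟨u, hu⟩ ⟨v, hv⟩ :=
  conn_iff' x y z w ω hu hv

/-- `tQ ω ↔ ω ∈ Q = {a₁ ↮ a₂}`. -/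
lemma tQ_iff (x y z w : Fin 5) (ω : Fin 14 → Bool) : tQ x y z w ω = true ↔ ω ∈ avoidAll (ends14 x y z w) 2 {1} := by
  unfold tQ
  rw [Bool.not_eq_true', Bool.eq_false_iff, Ne, conn_iff' x y z w ω (by norm_num) (by norm_num)]
  simp only [mem_avoidAll, Finset.mem_singleton, forall_eq]
  exact ⟨fun h hc => h (conn_symm hc), fun h hc => h (conn_symm hc)⟩

/-- `tL v ω ↔ ω ∈ {v ∈ C₁}`. -/
lemma tL_iff (x y z w : Fin 5) (v : Fin 6) (ω : Fin 14 → Bool) :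
    tL x y z w v ω = true ↔ ω ∈ connEvent (ends14 x y z w) 1 v :=
  conn_iff_mem x y z w ω (by norm_num) v.isLt

/-- `tH v ω ↔ ω ∈ {v ∈ C₂}`. -/
lemma tH_iff (x y z w : Fin 5) (v : Fin 6) (ω : Fin 14 → Bool) :
    tH x y z w v ω = true ↔ ω ∈ connEvent (ends14 x y z w) 2 v :=
  conn_iff_mem x y z w ω (by norm_num) v.isLt

/-- `tPD ω ↔ ω ∈ PD = Q ∩ {a₃ ∉ C₁ ∪ C₂}`. -/
lemma tPD_iff (x y z w : Fin 5) (ω : Fin 14 → Bool) : tPD x y z w ω = true ↔ ω ∈ PDEvent (ends14 x y z w) 1 2 5 := by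
  unfold tPD tL tH PDEvent Dtilde UnionCluster.inU
  rw [Bool.and_eq_true, Bool.and_eq_true, tQ_iff, Bool.not_eq_true', Bool.not_eq_true',
    Bool.eq_false_iff, Bool.eq_false_iff, Ne, Ne, conn_iff' x y z w ω (by norm_num) (by norm_num),
    conn_iff' x y z w ω (by norm_num) (by norm_num)]
  simp only [mem_avoidAll, Finset.mem_singleton, forall_eq, Set.mem_inter_iff, Set.mem_compl_iff,
    Set.mem_union, mem_connEvent]
  constructor
  · rintro ⟨⟨hQ, h15⟩, h25⟩
    exact ⟨fun h => hQ (conn_symm h), fun h => h.elim (fun h => h15 (conn_symm h))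
      (fun h => h25 (conn_symm h))⟩
  · rintro ⟨hQ, h⟩
    exact ⟨⟨fun h' => hQ (conn_symm h'), fun h' => h (Or.inl (conn_symm h'))⟩,
      fun h' => h (Or.inr (conn_symm h'))⟩

/-- `tPDoU ω ↔ ω ∈ PD ∩ {o ∈ C₁ ∪ C₂}`. -/
lemma tPDoU_iff (x y z w : Fin 5) (ω : Fin 14 → Bool) :
    tPDoU x y z w ω = true ↔
      ω ∈ PDEvent (ends14 x y z w) 1 2 5 ∩ (connEvent (ends14 x y z w) 1 0 ∪ connEvent (ends14 x y z w) 2 0) := by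
  unfold tPDoU tU tL tH
  rw [Bool.and_eq_true, tPD_iff, Bool.or_eq_true, conn_iff_mem x y z w ω (by norm_num) (by norm_num),
    conn_iff_mem x y z w ω (by norm_num) (by norm_num)]
  exact Iff.rfl

end Deg4

end Summit.Ventures.PercRepro2
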